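import Summits.QuantumFields.YangMills.Theorems.ParabolicTrajectoryLatticeGapOnTrajectorySlabClusteringTorusKernels
import Summits.QuantumFields.YangMills.Theorems.ParabolicTrajectoryLatticeGapOnTrajectoryStubWilsonTorusDLR
import Literature.Probability.LatticeModels.DobrushinShlosmanWindowDusting
import HarnessLib

/-!
# Crux `LatticeGapOnTrajectory` (stmt-QuantumFields-10523), line `sparse-defect-orbit-window`:
# stub (C) `stub_torusCrude` — the crude total-variation clause for Wilson's torus specification

Registered stub (C) of the line skeleton, `--supports stmt-QuantumFields-10523` (G-blind plumbing;
nothing about mass gaps is asserted, everything here is proved).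

For axis frames `q i : ℤ/(2S+1) → ℤ/(μ i + 1)` of scale `b`, a window
`W(c) = windowVol (cellOf q) n c = {e | cdist c (cellOf q e) ≤ n}`, a boundary cell `y` with
`cdist c y > n`, two boundary data `ω, η` agreeing off `y`, and a bounded measurable `f` reading only
`W(c)` with cell-Lipschitz bounds `δ` in the capped orbit weight `orbitWeight r α q` (`≤ 1`):
`|γ_W f(ω) − γ_W f(η)| ≤ 2 (1 + 2e²|β|α · 7680 b⁴) · (Σ_{x : cdist c x ≤ n} δ x) · w_y(ω, η)`,
`γ = torusYM r.ρ β (2S+1)`. Field `crude` of the typical window package `IsTypicalKRWindow`.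

Proof. (1) Recentre: the kernels `γ_Λ(· | θ)` are probability measures (`isSpecification_torusYM`),
so for `g := f − f(ω)` one has `γ_Λ g(θ) = γ_Λ f(θ) − f(ω)` and the two differences of window
averages agree. (2) Sup bound `‖g‖_∞ ≤ Σ_{x : cdist c x ≤ n} δ x`: one-cell interpolation
(`DobrushinShlosman.abs_sub_le_sum_cells` with `R = 1`) for the bounds `δ` truncated to the window —
off the window `f` does not move (`DependsOn`). (3) The TV-Lipschitz bound of the torus kernels in the
orbit weight for frames of scale `b`, `SlabClustering.abs_windowAvg_sub_le_orbitWeight_frame`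
(TorusKernels), applied to `g`.
-/

set_option autoImplicit false

noncomputable section

namespace Summit.QuantumFields.YangMills.Cruxes.LatticeGapOnTrajectory.SparseDefectOrbitWindow

open Filter MeasureTheory
open Literature.Probability.LatticeModels (Specification IsSpecification IsGibbsMeasure glueWith)
open Literature.MathematicalPhysics.QuantumFieldTheory
open Summit.QuantumFields.YangMills.Cruxes.LatticeGapOnTrajectory.OrbitKantorovichFiniteSize

namespace StubTorusCrude

/-! ### Recentring a window average -/

/-- **Recentring.** On a probability kernel, subtracting a constant from a bounded measurable
integrand subtracts it from the window average: `γ_Λ (f − a)(η) = γ_Λ f(η) − a`. -/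
theorem windowAvg_sub_const {V S : Type*} [MeasurableSpace S] (γ : Specification V S)
    (Λ : Finset V) (η : V → S) [IsProbabilityMeasure (γ Λ η)] {f : (V → S) → ℝ}
    (hf : Measurable f) {C : ℝ} (hfb : ∀ σ, |f σ| ≤ C) (a : ℝ) :
    windowAvg γ Λ (fun σ => f σ - a) η = windowAvg γ Λ f η - a := by
  have hint : Integrable f (γ Λ η) :=
    Integrable.of_bound hf.aestronglyMeasurable C (Eventually.of_forall fun σ => hfb σ)
  unfold windowAvg
  rw [integral_sub hint (integrable_const a), integral_const, probReal_univ, one_smul]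

/-! ### The sup bound of a window-local cell-Lipschitz function after recentring -/

/-- **One-cell interpolation, truncated to a set of cells.** If `f` has cell-Lipschitz bounds `δ`
for a weight `w ≤ 1` and reads only the sites whose cell satisfies `p`, then
`|f σ − f τ| ≤ Σ_{x : p x} δ x` for ALL `σ, τ` (`abs_sub_le_sum_cells` with `R = 1` and the bounds
`δ` truncated to `p`: off `p` the function does not move). -/
theorem abs_sub_le_sum_filter {ι V S : Type*} [Fintype ι] [DecidableEq ι] {cell : V → ι}
    {w : ι → (V → S) → (V → S) → ℝ} (hw1 : ∀ c σ τ, w c σ τ ≤ 1) {f : (V → S) → ℝ}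
    {δ : ι → ℝ} (hLip : IsCellLipBound cell w f δ) (p : ι → Prop) [DecidablePred p]
    (hdep : DependsOn f {v | p (cell v)}) (σ τ : V → S) :
    |f σ - f τ| ≤ ∑ x ∈ Finset.univ.filter p, δ x := by
  have h := Literature.Probability.LatticeModels.DobrushinShlosman.abs_sub_le_sum_cells
    (cell := cell) (w := w) (R := 1) hw1 (F := f) (δ := fun x => if p x then δ x else 0)
    (fun x => by
      split_ifs
      · exact hLip.nonneg x
      · exact le_rfl)
    (fun x σ' τ' hστ => by
      split_ifs with hx
      · exact hLip.le x σ' τ' hστ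
      · have hfeq : f σ' = f τ' :=
          hdep fun v hv => hστ v fun hvx => hx (by rw [← hvx]; exact hv)
        rw [hfeq, sub_self, abs_zero, zero_mul])
    σ τ
  rw [Finset.sum_filter]
  simpa only [one_mul] using h

end StubTorusCrude

/-- **Stub (C) `stub_torusCrude`** (G-blind): the CRUDE total-variation clause of the typical
package for Wilson's torus specification in the capped orbit weight on axis frames of scale `b`:
for a window `W(c)` of radius `n`, a boundary cell `y` with `cdist c y > n`, boundary data `ω, η`
agreeing off `y`, and a bounded measurable `f` reading only `W(c)` with cell-Lipschitz bounds `δ` in the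
orbit weight, `|γ_W f(ω) − γ_W f(η)| ≤ 2(1 + 2e²|β|α·7680 b⁴) · (Σ_{x ∈ W(c)} δ x) · w_y(ω, η)`.
Route: recentre `f ↦ f − f(ω)` (the kernels are probabilities), bound `‖f − f(ω)‖_∞ ≤ Σ_{W(c)} δ` by
one-cell interpolation (`abs_sub_le_sum_cells` with `R = 1`, weights `≤ 1`, `δ` restricted to the window
by `DependsOn`), then `abs_windowAvg_sub_le_orbitWeight_frame` (TorusKernels p121572). Field `crude`. -/
theorem stub_torusCrude :
    ∀ (G : Type) [Group G] [TopologicalSpace G] [IsTopologicalGroup G] [CompactSpace G]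
      [MeasurableSpace G] [BorelSpace G] (r : LatticeRep G) (β α : ℝ), 0 < α →
      ∀ {S : ℕ} {μ : Fin 4 → ℕ} (q : (i : Fin 4) → ZMod (2 * S + 1) → ZMod (μ i + 1)) {b : ℕ},
      (∀ i, IsTorusFrame (2 * S + 1) b (q i)) →
      ∀ (n : ℕ) (c y : CoarseIdx μ), n < cdist c y →
        ∀ (ω η : GaugeConfig 4 (2 * S + 1) G), (∀ e, cellOf q e ≠ y → ω e = η e) →
        ∀ (f : GaugeConfig 4 (2 * S + 1) G → ℝ) (δ : CoarseIdx μ → ℝ), Measurable f →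
          (∃ B, ∀ U, |f U| ≤ B) → DependsOn f {e | cdist c (cellOf q e) ≤ n} →
          IsCellLipBound (cellOf q) (orbitWeight r α q) f δ →
            |windowAvg (torusYM r.ρ β (2 * S + 1)) (windowVol (cellOf q) n c) f ω -
                windowAvg (torusYM r.ρ β (2 * S + 1)) (windowVol (cellOf q) n c) f η| ≤
              2 * (1 + 2 * Real.exp 2 * |β| * α * (7680 * (b : ℝ) ^ 4)) *
                (∑ x ∈ Finset.univ.filter (fun x => cdist c x ≤ n), δ x) *
                  orbitWeight r α q y ω η := by
  intro G _ _ _ _ _ _ r β α hα S μ q b hq n c y hcy ω η hωη f δ hf hfb hdep hLip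
  classical
  obtain ⟨C, hC⟩ := hfb
  -- notation
  set Λ : Finset (Edge 4 (2 * S + 1)) := windowVol (cellOf q) n c with hΛ
  set B : ℝ := ∑ x ∈ Finset.univ.filter (fun x => cdist c x ≤ n), δ x with hB
  set g : GaugeConfig 4 (2 * S + 1) G → ℝ := fun U => f U - f ω with hg
  -- (1) recentre: the kernels are probability measures
  have hspec : IsSpecification (torusYM r.ρ β (2 * S + 1)) := isSpecification_torusYM r β (2 * S + 1)
  have hrec : ∀ θ, windowAvg (torusYM r.ρ β (2 * S + 1)) Λ g θ =
      windowAvg (torusYM r.ρ β (2 * S + 1)) Λ f θ - f ω := fun θ => by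
    haveI := hspec.isProbability Λ θ
    exact StubTorusCrude.windowAvg_sub_const (torusYM r.ρ β (2 * S + 1)) Λ θ hf hC (f ω)
  have hdiff : windowAvg (torusYM r.ρ β (2 * S + 1)) Λ f ω - windowAvg (torusYM r.ρ β (2 * S + 1)) Λ f η =
      windowAvg (torusYM r.ρ β (2 * S + 1)) Λ g ω - windowAvg (torusYM r.ρ β (2 * S + 1)) Λ g η := by
    rw [hrec, hrec]; ring
  -- (2) the sup bound of the recentred function
  have hw1 : ∀ (x : CoarseIdx μ) (σ τ : GaugeConfig 4 (2 * S + 1) G), orbitWeight r α q x σ τ ≤ 1 :=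
    fun x σ τ => min_le_left _ _
  have hgb : ∀ U, |g U| ≤ B := fun U =>
    StubTorusCrude.abs_sub_le_sum_filter hw1 hLip (fun x => cdist c x ≤ n) hdep U ω
  have hgm : Measurable g := hf.sub measurable_const
  have hgdep : DependsOn g (↑Λ : Set (Edge 4 (2 * S + 1))) := by
    intro U V hUV
    simp only [hg]
    rw [hdep fun e he => hUV e ?_]
    rw [Finset.mem_coe, hΛ, windowVol, Finset.mem_filter]
    exact ⟨Finset.mem_univ _, he⟩
  -- the boundary cell carries no link of the window
  have hy : ∀ e ∈ Λ, cellOf q e ≠ y := by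
    intro e he hey
    have he' : cdist c (cellOf q e) ≤ n := (Finset.mem_filter.1 he).2
    rw [hey] at he'
    exact absurd hcy (not_lt.2 he')
  -- (3) the TV-Lipschitz bound of the torus kernels in the orbit weight
  have key := SlabClustering.abs_windowAvg_sub_le_orbitWeight_frame r β α hα q hq Λ y hy hgm hgdep hgb
    ω η hωη
  rw [hdiff]
  calc _ ≤ 2 * B * (1 + 2 * Real.exp 2 * |β| * α * (7680 * (b : ℝ) ^ 4)) * orbitWeight r α q y ω η := key
    _ = 2 * (1 + 2 * Real.exp 2 * |β| * α * (7680 * (b : ℝ) ^ 4)) * B * orbitWeight r α q y ω η := by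
        ring

end Summit.QuantumFields.YangMills.Cruxes.LatticeGapOnTrajectory.SparseDefectOrbitWindow

end
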